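import Mathlib
import Literature.Analysis.ODE.HolomorphicLinearODEStarConvex
import HarnessLib

/-!
# Nonlinear holomorphic ODEs on a disc: the a-posteriori (tube) form of the complex Picard–Lindelöf theorem

Topic `Analysis/ODE`. The classical theorem of Cauchy–Picard in the complex domain (Hille, *Ordinary Differential
Equations in the Complex Domain* (1976), Thm. 2.3.1; Coddington–Levinson, *Theory of Ordinary Differential Equations*
(1955), Ch. 1 §8 "Complex systems"): `y′ = F(y)` with `F` holomorphic has a unique holomorphic solution through a
prescribed value, obtained by successive approximations. We prove it in the QUANTITATIVE, A-POSTERIORI form that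
computer-assisted analytic continuation consumes (the "validated tube" of interval methods, Moore, *Interval Analysis*
(1966), Ch. 10; here in complex time): on the disc `|w − c| < R` one is GIVEN an approximate solution `ŷ` (holomorphic,
e.g. a polynomial) with defect `‖ŷ′ − F(ŷ)‖ ≤ δ`, an initial discrepancy `‖y₀ − ŷ(c)‖ ≤ ε₀`, and a set `B` on which `F` is
`K`-Lipschitz and which contains the tube `‖v − ŷ(w)‖ ≤ γ(|w − c|)`, `γ(s) = (ε₀ + δ s) e^{K s}` (the Grönwall bound);
THEN the exact solution with `y(c) = y₀` exists as a HOLOMORPHIC function on the whole disc, stays in the tube, and is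
unique there:
* `tubeBound` and the scalar Grönwall inequality `tubeBound_integral_le`;
* `picardMap` (`G ↦ y₀ + ∫_{[c,w]} F ∘ G`, written with the ray primitive of
  `Literature.Analysis.ODE.hasDerivAt_rayPrimitive`), its holomorphy `hasDerivAt_picardMap`, and the tube invariance
  `norm_picardMap_sub_le` (the Picard map sends the tube into itself);
* `picardIter`, the factorial estimate `norm_picardIter_succ_sub_le`, and the main theorem
  `exists_holomorphic_solution_in_tube` (existence, holomorphy, `y(c) = y₀`, tube bound);
* `solution_unique_of_ball` (uniqueness among solutions with values in `B`, Grönwall along rays).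
Everything is proved; `E` is any complex Banach space. Problem-independent (written for the certified analytic
continuation of the Buckmaster–Cao-Labora–Gómez-Serrano implosion profile into a complex wedge, where `ŷ` is a
kernel-checked Taylor polynomial and `δ, ε₀, K` are rational certificate data).
References: E. Hille, *Ordinary Differential Equations in the Complex Domain*, Wiley (1976), §2.3, Thm. 2.3.1 [Hille1976];
E. A. Coddington, N. Levinson, *Theory of Ordinary Differential Equations*, McGraw–Hill (1955), Ch. 1 §3, §8
[CoddingtonLevinson1955]; R. E. Moore, *Interval Analysis*, Prentice–Hall (1966), Ch. 10 [Moore1966].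
-/

noncomputable section

open Set Metric Filter MeasureTheory intervalIntegral
open scoped Topology Nat NNReal

namespace Literature.Analysis.ODE

variable {E : Type*} [NormedAddCommGroup E] [NormedSpace ℂ E]

/-! ## The Grönwall tube bound -/

/-- The tube radius `γ(s) = (ε₀ + δ s) e^{K s}`: the Grönwall bound for an approximate solution with initial error `ε₀`,
defect `δ` and Lipschitz constant `K`, at distance `s` from the centre. [cite: CoddingtonLevinson1955, Ch. 1 §3] -/
def tubeBound (ε₀ δ K s : ℝ) : ℝ := (ε₀ + δ * s) * Real.exp (K * s)

/-- [folklore] -/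
theorem tubeBound_zero (ε₀ δ K : ℝ) : tubeBound ε₀ δ K 0 = ε₀ := by simp [tubeBound]

/-- [folklore] -/
theorem tubeBound_nonneg {ε₀ δ K s : ℝ} (hε₀ : 0 ≤ ε₀) (hδ : 0 ≤ δ) (hs : 0 ≤ s) : 0 ≤ tubeBound ε₀ δ K s := by
  unfold tubeBound; positivity

/-- `ε₀ + δ s ≤ γ(s)` for `K, s ≥ 0`. [folklore] -/
theorem add_mul_le_tubeBound {ε₀ δ K s : ℝ} (hε₀ : 0 ≤ ε₀) (hδ : 0 ≤ δ) (hK : 0 ≤ K) (hs : 0 ≤ s) :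
    ε₀ + δ * s ≤ tubeBound ε₀ δ K s := by
  unfold tubeBound
  have h1 : 1 ≤ Real.exp (K * s) := Real.one_le_exp (by positivity)
  have h0 : 0 ≤ ε₀ + δ * s := by positivity
  nlinarith

/-- `γ` is monotone on `[0, ∞)` for `δ, K ≥ 0`. [folklore] -/
theorem tubeBound_mono {ε₀ δ K s₁ s₂ : ℝ} (hε₀ : 0 ≤ ε₀) (hδ : 0 ≤ δ) (hK : 0 ≤ K) (hs₁ : 0 ≤ s₁) (h : s₁ ≤ s₂) :
    tubeBound ε₀ δ K s₁ ≤ tubeBound ε₀ δ K s₂ := by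
  unfold tubeBound
  have h1 : Real.exp (K * s₁) ≤ Real.exp (K * s₂) := Real.exp_le_exp.mpr (by nlinarith)
  have h2 : ε₀ + δ * s₁ ≤ ε₀ + δ * s₂ := by nlinarith
  have h3 : 0 ≤ ε₀ + δ * s₁ := by positivity
  have h4 : 0 ≤ Real.exp (K * s₂) := (Real.exp_pos _).le
  calc (ε₀ + δ * s₁) * Real.exp (K * s₁) ≤ (ε₀ + δ * s₁) * Real.exp (K * s₂) :=
        mul_le_mul_of_nonneg_left h1 h3
    _ ≤ (ε₀ + δ * s₂) * Real.exp (K * s₂) := mul_le_mul_of_nonneg_right h2 h4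

/-- The derivative of `γ`. [folklore] -/
theorem hasDerivAt_tubeBound (ε₀ δ K s : ℝ) :
    HasDerivAt (tubeBound ε₀ δ K) (δ * Real.exp (K * s) + K * tubeBound ε₀ δ K s) s := by
  have h1 : HasDerivAt (fun x : ℝ => ε₀ + δ * x) (δ * 1) s := ((hasDerivAt_id' s).const_mul δ).const_add ε₀
  have h2 : HasDerivAt (fun x : ℝ => Real.exp (K * x)) (Real.exp (K * s) * (K * 1)) s :=
    ((hasDerivAt_id' s).const_mul K).exp
  have h := h1.mul h2
  have e : ((fun x : ℝ => ε₀ + δ * x) * fun x : ℝ => Real.exp (K * x)) = tubeBound ε₀ δ K := by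
    funext x; rfl
  rw [e] at h
  refine h.congr_deriv ?_
  unfold tubeBound; ring

/-- `γ′` is continuous. [folklore] -/
theorem continuous_tubeBound (ε₀ δ K : ℝ) : Continuous (tubeBound ε₀ δ K) := by
  unfold tubeBound; fun_prop

/-- **The scalar Grönwall inequality behind the tube**: `ε₀ + δ s + ∫₀ˢ K γ(σ) dσ ≤ γ(s)` for `s ≥ 0` (indeed
`γ′ = δ e^{Kσ} + K γ ≥ δ + K γ`). [cite: CoddingtonLevinson1955, Ch. 1 §3] -/
theorem tubeBound_integral_le {ε₀ δ K s : ℝ} (hδ : 0 ≤ δ) (hK : 0 ≤ K) (hs : 0 ≤ s) :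
    ε₀ + δ * s + ∫ σ in (0 : ℝ)..s, K * tubeBound ε₀ δ K σ ≤ tubeBound ε₀ δ K s := by
  set γ := tubeBound ε₀ δ K with hγ
  have hcγ : Continuous γ := continuous_tubeBound ε₀ δ K
  have hder : ∀ σ ∈ uIcc (0 : ℝ) s, HasDerivAt γ (δ * Real.exp (K * σ) + K * γ σ) σ := fun σ _ =>
    hasDerivAt_tubeBound ε₀ δ K σ
  have hcont' : Continuous fun σ : ℝ => δ * Real.exp (K * σ) + K * γ σ := by fun_prop
  have hftc : ∫ σ in (0 : ℝ)..s, (δ * Real.exp (K * σ) + K * γ σ) = γ s - γ 0 :=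
    integral_eq_sub_of_hasDerivAt hder (hcont'.intervalIntegrable _ _)
  have hmono : ∫ σ in (0 : ℝ)..s, (δ + K * γ σ) ≤ ∫ σ in (0 : ℝ)..s, (δ * Real.exp (K * σ) + K * γ σ) := by
    refine integral_mono_on hs ((continuous_const.add (continuous_const.mul hcγ)).intervalIntegrable _ _)
      (hcont'.intervalIntegrable _ _) fun σ hσ => ?_
    have h1 : 1 ≤ Real.exp (K * σ) := Real.one_le_exp (by nlinarith [hσ.1])
    nlinarith
  have hiK : IntervalIntegrable (fun σ : ℝ => K * γ σ) volume 0 s := (continuous_const.mul hcγ).intervalIntegrable _ _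
  have hiδ : IntervalIntegrable (fun _ : ℝ => δ) volume 0 s := continuous_const.intervalIntegrable _ _
  have hsplit : ∫ σ in (0 : ℝ)..s, (δ + K * γ σ) = δ * s + ∫ σ in (0 : ℝ)..s, K * γ σ := by
    rw [integral_add hiδ hiK, intervalIntegral.integral_const, sub_zero, smul_eq_mul, mul_comm]
  have h0 : γ 0 = ε₀ := tubeBound_zero ε₀ δ K
  linarith

/-! ## Rays in a ball -/

/-- A ball is star-convex with respect to its centre. [folklore] -/
theorem starConvex_ball_center (c : ℂ) {R : ℝ} (hR : 0 < R) : StarConvex ℝ c (ball c R) :=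
  (convex_ball c R).starConvex (mem_ball_self hR)

/-- Ray points of a ball point lie in the ball. [folklore] -/
theorem ray_mem_ball {c w : ℂ} {R : ℝ} (hR : 0 < R) (hw : w ∈ ball c R) {t : ℝ} (ht : t ∈ Icc (0 : ℝ) 1) :
    c + (t : ℂ) * (w - c) ∈ ball c R :=
  ray_mem_of_starConvex (starConvex_ball_center c hR) hw ht

/-- Distance of a ray point to the centre. [folklore] -/
theorem norm_ray_sub_center (c w : ℂ) {t : ℝ} (ht : 0 ≤ t) : ‖c + (t : ℂ) * (w - c) - c‖ = t * ‖w - c‖ := by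
  rw [add_sub_cancel_left, norm_mul, Complex.norm_real, Real.norm_eq_abs, abs_of_nonneg ht]

omit [NormedSpace ℂ E] in
/-- Norm of a ray integral against a continuous majorant: `‖(w − c) • ∫₀¹ H(c + t(w − c)) dt‖ ≤ ‖w − c‖ ∫₀¹ g`.
[folklore] -/
theorem norm_raySmul_integral_le [NormedSpace ℂ E] {c w : ℂ} {H : ℂ → E} {g : ℝ → ℝ} (hg : Continuous g)
    (h : ∀ t ∈ Icc (0 : ℝ) 1, ‖H (c + (t : ℂ) * (w - c))‖ ≤ g t) :
    ‖(w - c) • ∫ t in (0 : ℝ)..1, H (c + (t : ℂ) * (w - c))‖ ≤ ‖w - c‖ * ∫ t in (0 : ℝ)..1, g t := by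
  rw [norm_smul]
  refine mul_le_mul_of_nonneg_left ?_ (norm_nonneg _)
  exact norm_integral_le_of_norm_le zero_le_one (Eventually.of_forall fun t ht => h t ⟨ht.1.le, ht.2⟩)
    (hg.intervalIntegrable _ _)

/-! ## The Picard map -/

/-- The Picard map `G ↦ (w ↦ y₀ + (w − c) • ∫₀¹ F(G(c + t(w − c))) dt)` = `y₀ + ∫_{[c,w]} F ∘ G`.
[cite: Hille1976, §2.3] -/
def picardMap (F : E → E) (c : ℂ) (y₀ : E) (G : ℂ → E) : ℂ → E :=
  fun w => y₀ + (w - c) • ∫ t in (0 : ℝ)..1, F (G (c + (t : ℂ) * (w - c)))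

/-- [folklore] -/
theorem picardMap_apply (F : E → E) (c : ℂ) (y₀ : E) (G : ℂ → E) (w : ℂ) :
    picardMap F c y₀ G w = y₀ + (w - c) • ∫ t in (0 : ℝ)..1, F (G (c + (t : ℂ) * (w - c))) := rfl

/-- At the centre the Picard map returns the initial value. [folklore] -/
theorem picardMap_center (F : E → E) (c : ℂ) (y₀ : E) (G : ℂ → E) : picardMap F c y₀ G c = y₀ := by
  simp [picardMap]

variable [CompleteSpace E]

/-- **The Picard map of a holomorphic function is holomorphic**, with derivative `F ∘ G`: for `G` holomorphic on the
ball with values in the set `V` on which `F` is holomorphic. [cite: Hille1976, §2.3] -/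
theorem hasDerivAt_picardMap {F : E → E} {V : Set E} (hF : DifferentiableOn ℂ F V) {c : ℂ} {R : ℝ}
    (hR : 0 < R) (y₀ : E) {G : ℂ → E} (hG : DifferentiableOn ℂ G (ball c R)) (hGV : MapsTo G (ball c R) V) {w : ℂ}
    (hw : w ∈ ball c R) : HasDerivAt (picardMap F c y₀ G) (F (G w)) w := by
  have h := hasDerivAt_rayPrimitive (U := ball c R) (z₀ := c) (H := fun u => F (G u)) isOpen_ball
    (starConvex_ball_center c hR) (hF.comp hG hGV) hw
  exact h.const_add y₀

omit [NormedSpace ℂ E] [CompleteSpace E] in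
/-- Continuity of `t ↦ F (G (c + t (w − c)))` on `[0, 1]`. [folklore] -/
theorem continuousOn_comp_ray {F : E → E} {V : Set E} (hFc : ContinuousOn F V) {c : ℂ} {R : ℝ} (hR : 0 < R)
    {G : ℂ → E} (hG : ContinuousOn G (ball c R)) (hGV : MapsTo G (ball c R) V) {w : ℂ} (hw : w ∈ ball c R) :
    ContinuousOn (fun t : ℝ => F (G (c + (t : ℂ) * (w - c)))) (Icc 0 1) := by
  refine hFc.comp (hG.comp (by fun_prop) fun t ht => ray_mem_ball hR hw ht) fun t ht => hGV (ray_mem_ball hR hw ht)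

omit [CompleteSpace E] in
/-- **Lipschitz estimate for the Picard map.** If `F` is `K`-Lipschitz on `B` (`K ≥ 0`) and `G₁, G₂` are continuous on
the ball with values in `B`, with `‖G₁ − G₂‖ ≤ g(t)` along the ray to `w` (`g` continuous), then
`‖picardMap G₁ w − picardMap G₂ w‖ ≤ ‖w − c‖ ∫₀¹ K g`. [cite: CoddingtonLevinson1955, Ch. 1 §3] -/
theorem norm_picardMap_sub_picardMap_le {F : E → E} {V B : Set E} (hBV : B ⊆ V) (hFc : ContinuousOn F V) {K : ℝ}
    (hK : 0 ≤ K) (hLip : ∀ u ∈ B, ∀ v ∈ B, ‖F u - F v‖ ≤ K * ‖u - v‖) {c : ℂ} {R : ℝ} (hR : 0 < R) (y₀ : E)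
    {G₁ G₂ : ℂ → E} (hG₁ : ContinuousOn G₁ (ball c R)) (hG₂ : ContinuousOn G₂ (ball c R))
    (hB₁ : MapsTo G₁ (ball c R) B) (hB₂ : MapsTo G₂ (ball c R) B) {w : ℂ} (hw : w ∈ ball c R) {g : ℝ → ℝ}
    (hg : Continuous g) (hdist : ∀ t ∈ Icc (0 : ℝ) 1, ‖G₁ (c + (t : ℂ) * (w - c)) - G₂ (c + (t : ℂ) * (w - c))‖ ≤ g t) :
    ‖picardMap F c y₀ G₁ w - picardMap F c y₀ G₂ w‖ ≤ ‖w - c‖ * ∫ t in (0 : ℝ)..1, K * g t := by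
  have hi₁ : IntervalIntegrable (fun t : ℝ => F (G₁ (c + (t : ℂ) * (w - c)))) volume 0 1 :=
    ((continuousOn_comp_ray hFc hR hG₁ (fun u hu => hBV (hB₁ hu)) hw).mono (by rw [uIcc_of_le zero_le_one])).intervalIntegrable
  have hi₂ : IntervalIntegrable (fun t : ℝ => F (G₂ (c + (t : ℂ) * (w - c)))) volume 0 1 :=
    ((continuousOn_comp_ray hFc hR hG₂ (fun u hu => hBV (hB₂ hu)) hw).mono (by rw [uIcc_of_le zero_le_one])).intervalIntegrable
  have e : picardMap F c y₀ G₁ w - picardMap F c y₀ G₂ w =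
      (w - c) • ∫ t in (0 : ℝ)..1, (F (G₁ (c + (t : ℂ) * (w - c))) - F (G₂ (c + (t : ℂ) * (w - c)))) := by
    rw [picardMap_apply, picardMap_apply, integral_sub hi₁ hi₂, smul_sub]
    abel
  rw [e]
  refine norm_raySmul_integral_le (H := fun u => F (G₁ u) - F (G₂ u)) (continuous_const.mul hg) fun t ht => ?_
  have hm : c + (t : ℂ) * (w - c) ∈ ball c R := ray_mem_ball hR hw ht
  exact (hLip _ (hB₁ hm) _ (hB₂ hm)).trans (mul_le_mul_of_nonneg_left (hdist t ht) hK)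

omit [CompleteSpace E] in
/-- The Lipschitz estimate with a power majorant: `‖G₁ − G₂‖ ≤ C tⁿ` along the ray gives
`‖picardMap G₁ w − picardMap G₂ w‖ ≤ ‖w − c‖ · K C/(n+1)` (the factorial gain of the Picard iteration).
[cite: CoddingtonLevinson1955, Ch. 1 §3] -/
theorem norm_picardMap_sub_picardMap_le_pow {F : E → E} {V B : Set E} (hBV : B ⊆ V) (hFc : ContinuousOn F V) {K : ℝ}
    (hK : 0 ≤ K) (hLip : ∀ u ∈ B, ∀ v ∈ B, ‖F u - F v‖ ≤ K * ‖u - v‖) {c : ℂ} {R : ℝ} (hR : 0 < R) (y₀ : E)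
    {G₁ G₂ : ℂ → E} (hG₁ : ContinuousOn G₁ (ball c R)) (hG₂ : ContinuousOn G₂ (ball c R))
    (hB₁ : MapsTo G₁ (ball c R) B) (hB₂ : MapsTo G₂ (ball c R) B) {w : ℂ} (hw : w ∈ ball c R) {C : ℝ} {n : ℕ}
    (hdist : ∀ t ∈ Icc (0 : ℝ) 1, ‖G₁ (c + (t : ℂ) * (w - c)) - G₂ (c + (t : ℂ) * (w - c))‖ ≤ C * t ^ n) :
    ‖picardMap F c y₀ G₁ w - picardMap F c y₀ G₂ w‖ ≤ ‖w - c‖ * (K * C / (n + 1)) := by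
  have h := norm_picardMap_sub_picardMap_le hBV hFc hK hLip hR y₀ hG₁ hG₂ hB₁ hB₂ hw (g := fun t => C * t ^ n)
    (by fun_prop) hdist
  have e : ∫ t in (0 : ℝ)..1, K * (C * t ^ n) = K * C / (n + 1) := by
    have : (fun t : ℝ => K * (C * t ^ n)) = fun t : ℝ => (K * C) * t ^ n := funext fun t => by ring
    rw [this, intervalIntegral.integral_const_mul, integral_pow]
    simp [div_eq_mul_inv]
  rw [e] at h
  exact h

/-- **The Picard map sends the tube into itself.** With `F` `K`-Lipschitz on `B ⊇ tube`, defect `‖ŷ′ − F(ŷ)‖ ≤ δ`,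
`‖y₀ − ŷ(c)‖ ≤ ε₀`: if `‖G − ŷ‖ ≤ γ(|w − c|)` on the ball then `‖picardMap G − ŷ‖ ≤ γ(|w − c|)`
(`γ = tubeBound ε₀ δ K`; this is where `tubeBound_integral_le` enters). [cite: Moore1966, Ch. 10] -/
theorem norm_picardMap_sub_le {F : E → E} {V B : Set E} (hBV : B ⊆ V) (hF : DifferentiableOn ℂ F V) {K : ℝ}
    (hK : 0 ≤ K) (hLip : ∀ u ∈ B, ∀ v ∈ B, ‖F u - F v‖ ≤ K * ‖u - v‖) {c : ℂ} {R : ℝ} (hR : 0 < R)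
    {ŷ : ℂ → E} (hŷ : DifferentiableOn ℂ ŷ (ball c R)) {δ ε₀ : ℝ} (hδ : 0 ≤ δ) (hε₀ : 0 ≤ ε₀)
    (hdef : ∀ w ∈ ball c R, ‖deriv ŷ w - F (ŷ w)‖ ≤ δ)
    (htube : ∀ w ∈ ball c R, closedBall (ŷ w) (tubeBound ε₀ δ K ‖w - c‖) ⊆ B) {y₀ : E} (hy₀ : ‖y₀ - ŷ c‖ ≤ ε₀)
    {G : ℂ → E} (hGc : ContinuousOn G (ball c R)) (hGt : ∀ w ∈ ball c R, ‖G w - ŷ w‖ ≤ tubeBound ε₀ δ K ‖w - c‖)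
    {w : ℂ} (hw : w ∈ ball c R) : ‖picardMap F c y₀ G w - ŷ w‖ ≤ tubeBound ε₀ δ K ‖w - c‖ := by
  set s := ‖w - c‖ with hs
  have hs0 : 0 ≤ s := norm_nonneg _
  have hŷc : ContinuousOn ŷ (ball c R) := hŷ.continuousOn
  have hŷB : MapsTo ŷ (ball c R) B := fun u hu =>
    htube u hu (mem_closedBall_self (tubeBound_nonneg hε₀ hδ (norm_nonneg _)))
  have hGB : MapsTo G (ball c R) B := fun u hu =>
    htube u hu (mem_closedBall.2 (by rw [dist_eq_norm]; exact hGt u hu))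
  -- the Lipschitz term
  have h1 : ‖picardMap F c y₀ G w - picardMap F c y₀ ŷ w‖ ≤ s * ∫ t in (0 : ℝ)..1, K * tubeBound ε₀ δ K (s * t) := by
    refine norm_picardMap_sub_picardMap_le hBV hF.continuousOn hK hLip hR y₀ hGc hŷc hGB hŷB hw
      (g := fun t => tubeBound ε₀ δ K (s * t)) ((continuous_tubeBound ε₀ δ K).comp (continuous_const.mul continuous_id))
      fun t ht => ?_
    have h := hGt _ (ray_mem_ball hR hw ht)
    rw [norm_ray_sub_center c w ht.1, mul_comm t ‖w - c‖] at h
    exact h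
  have hcv : s * ∫ t in (0 : ℝ)..1, K * tubeBound ε₀ δ K (s * t) = ∫ σ in (0 : ℝ)..s, K * tubeBound ε₀ δ K σ := by
    have h := intervalIntegral.smul_integral_comp_mul_left (f := fun σ => K * tubeBound ε₀ δ K σ) (a := (0 : ℝ)) (b := 1) s
    simp only [smul_eq_mul, mul_zero, mul_one] at h
    exact h
  -- the defect term: `D = picardMap ŷ − ŷ` has `‖D′‖ ≤ δ` and `D(c) = y₀ − ŷ(c)`
  have hD : ∀ u ∈ ball c R, HasDerivAt (fun u => picardMap F c y₀ ŷ u - ŷ u) (F (ŷ u) - deriv ŷ u) u := fun u hu =>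
    (hasDerivAt_picardMap hF hR y₀ hŷ (fun v hv => hBV (hŷB hv)) hu).sub
      ((hŷ.differentiableAt (isOpen_ball.mem_nhds hu)).hasDerivAt)
  have h2 : ‖(picardMap F c y₀ ŷ w - ŷ w) - (picardMap F c y₀ ŷ c - ŷ c)‖ ≤ δ * ‖w - c‖ :=
    (convex_ball c R).norm_image_sub_le_of_norm_deriv_le (f := fun u => picardMap F c y₀ ŷ u - ŷ u)
      (fun u hu => (hD u hu).differentiableAt)
      (fun u hu => by rw [(hD u hu).deriv, norm_sub_rev]; exact hdef u hu) (mem_ball_self hR) hw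
  have h3 : ‖picardMap F c y₀ ŷ w - ŷ w‖ ≤ ε₀ + δ * s := by
    have e : picardMap F c y₀ ŷ w - ŷ w =
        ((picardMap F c y₀ ŷ w - ŷ w) - (picardMap F c y₀ ŷ c - ŷ c)) + (y₀ - ŷ c) := by
      rw [picardMap_center]; abel
    rw [e]
    calc ‖(picardMap F c y₀ ŷ w - ŷ w - (picardMap F c y₀ ŷ c - ŷ c)) + (y₀ - ŷ c)‖
        ≤ ‖picardMap F c y₀ ŷ w - ŷ w - (picardMap F c y₀ ŷ c - ŷ c)‖ + ‖y₀ - ŷ c‖ := norm_add_le _ _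
      _ ≤ δ * s + ε₀ := add_le_add h2 hy₀
      _ = ε₀ + δ * s := by ring
  -- combine
  have e : picardMap F c y₀ G w - ŷ w =
      (picardMap F c y₀ G w - picardMap F c y₀ ŷ w) + (picardMap F c y₀ ŷ w - ŷ w) := by abel
  rw [e]
  calc ‖(picardMap F c y₀ G w - picardMap F c y₀ ŷ w) + (picardMap F c y₀ ŷ w - ŷ w)‖
      ≤ ‖picardMap F c y₀ G w - picardMap F c y₀ ŷ w‖ + ‖picardMap F c y₀ ŷ w - ŷ w‖ := norm_add_le _ _
    _ ≤ s * (∫ t in (0 : ℝ)..1, K * tubeBound ε₀ δ K (s * t)) + (ε₀ + δ * s) := add_le_add h1 h3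
    _ = ε₀ + δ * s + ∫ σ in (0 : ℝ)..s, K * tubeBound ε₀ δ K σ := by rw [hcv]; ring
    _ ≤ tubeBound ε₀ δ K s := tubeBound_integral_le hδ hK hs0

/-! ## The main theorem -/

/-- **Holomorphic Cauchy–Picard theorem on a disc, a-posteriori (validated tube) form.** Let `F` be holomorphic on `V`,
`K`-Lipschitz on `B ⊆ V`; let `ŷ` be holomorphic on the disc `|w − c| < R` with defect `‖ŷ′(w) − F(ŷ(w))‖ ≤ δ`, and
`‖y₀ − ŷ(c)‖ ≤ ε₀`; suppose the Grönwall tube `‖v − ŷ(w)‖ ≤ γ(|w − c|)`, `γ(s) = (ε₀ + δ s)e^{Ks}`, lies in `B`. Then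
there is `y`, HOLOMORPHIC on the disc, with `y(c) = y₀`, `y′ = F(y)` on the disc, and `‖y(w) − ŷ(w)‖ ≤ γ(|w − c|)`.
Proof: Picard iteration `yₙ₊₁ = y₀ + ∫_{[c,w]} F ∘ yₙ` from `y₀ := ŷ`; the tube is invariant (`norm_picardMap_sub_le`),
`‖yₙ₊₁ − yₙ‖ ≤ γ(R)(K|w − c|)ⁿ/n!`, so `y = ŷ + Σ(yₙ₊₁ − yₙ)` converges uniformly, is holomorphic
(`Complex.differentiableOn_tsum_of_summable_norm`) and is a fixed point of the Picard map, whose derivative is `F ∘ y`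
(`hasDerivAt_rayPrimitive`). [cite: Hille1976, §2.3, Thm 2.3.1] -/
theorem exists_holomorphic_solution_in_tube {F : E → E} {V B : Set E} (hBV : B ⊆ V) (hF : DifferentiableOn ℂ F V)
    {K : ℝ} (hK : 0 ≤ K) (hLip : ∀ u ∈ B, ∀ v ∈ B, ‖F u - F v‖ ≤ K * ‖u - v‖) {c : ℂ} {R : ℝ} (hR : 0 < R)
    {ŷ : ℂ → E} (hŷ : DifferentiableOn ℂ ŷ (ball c R)) {δ ε₀ : ℝ} (hδ : 0 ≤ δ) (hε₀ : 0 ≤ ε₀)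
    (hdef : ∀ w ∈ ball c R, ‖deriv ŷ w - F (ŷ w)‖ ≤ δ)
    (htube : ∀ w ∈ ball c R, closedBall (ŷ w) (tubeBound ε₀ δ K ‖w - c‖) ⊆ B) {y₀ : E} (hy₀ : ‖y₀ - ŷ c‖ ≤ ε₀) :
    ∃ y : ℂ → E, DifferentiableOn ℂ y (ball c R) ∧ y c = y₀ ∧ (∀ w ∈ ball c R, HasDerivAt y (F (y w)) w) ∧
      ∀ w ∈ ball c R, ‖y w - ŷ w‖ ≤ tubeBound ε₀ δ K ‖w - c‖ := by
  set γ : ℝ → ℝ := tubeBound ε₀ δ K with hγ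
  set T : (ℂ → E) → ℂ → E := picardMap F c y₀ with hT
  set Y : ℕ → ℂ → E := fun n => T^[n] ŷ with hY
  have hY0 : Y 0 = ŷ := rfl
  have hYsucc : ∀ n, Y (n + 1) = T (Y n) := fun n => Function.iterate_succ_apply' T n ŷ
  have hFc : ContinuousOn F V := hF.continuousOn
  -- the invariant: holomorphic, inside the tube
  have hinv : ∀ n, DifferentiableOn ℂ (Y n) (ball c R) ∧ ∀ w ∈ ball c R, ‖Y n w - ŷ w‖ ≤ γ ‖w - c‖ := by
    intro n
    induction n with
    | zero =>
      refine ⟨by rw [hY0]; exact hŷ, fun w _ => ?_⟩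
      rw [hY0, sub_self, norm_zero]
      exact tubeBound_nonneg hε₀ hδ (norm_nonneg _)
    | succ n ih =>
      have hB : MapsTo (Y n) (ball c R) B := fun u hu =>
        htube u hu (mem_closedBall.2 (by rw [dist_eq_norm]; exact ih.2 u hu))
      refine ⟨fun w hw => ?_, fun w hw => ?_⟩
      · rw [hYsucc]
        exact (hasDerivAt_picardMap hF hR y₀ ih.1 (fun u hu => hBV (hB hu)) hw).differentiableAt.differentiableWithinAt
      · rw [hYsucc]
        exact norm_picardMap_sub_le hBV hF hK hLip hR hŷ hδ hε₀ hdef htube hy₀ ih.1.continuousOn ih.2 hw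
  have hYd : ∀ n, DifferentiableOn ℂ (Y n) (ball c R) := fun n => (hinv n).1
  have hYt : ∀ n, ∀ w ∈ ball c R, ‖Y n w - ŷ w‖ ≤ γ ‖w - c‖ := fun n => (hinv n).2
  have hYB : ∀ n, MapsTo (Y n) (ball c R) B := fun n u hu =>
    htube u hu (mem_closedBall.2 (by rw [dist_eq_norm]; exact hYt n u hu))
  have hYc : ∀ n, ContinuousOn (Y n) (ball c R) := fun n => (hYd n).continuousOn
  have hY' : ∀ n, ∀ w ∈ ball c R, HasDerivAt (Y (n + 1)) (F (Y n w)) w := fun n w hw => by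
    rw [hYsucc]; exact hasDerivAt_picardMap hF hR y₀ (hYd n) (fun u hu => hBV (hYB n hu)) hw
  -- the factorial estimate
  set M : ℝ := γ R with hM
  have hM0 : 0 ≤ M := tubeBound_nonneg hε₀ hδ hR.le
  have hsR : ∀ w ∈ ball c R, ‖w - c‖ ≤ R := fun w hw => by
    rw [← dist_eq_norm]; exact (mem_ball.1 hw).le
  have hest : ∀ n, ∀ w ∈ ball c R, ‖Y (n + 1) w - Y n w‖ ≤ M * (K * ‖w - c‖) ^ n / n ! := by
    intro n
    induction n with
    | zero =>
      intro w hw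
      have h := hYt 1 w hw
      rw [hY0]
      simp only [pow_zero, Nat.factorial_zero, Nat.cast_one, div_one, mul_one]
      exact h.trans (tubeBound_mono hε₀ hδ hK (norm_nonneg _) (hsR w hw))
    | succ n ih =>
      intro w hw
      set s := ‖w - c‖ with hs
      have key : ∀ t ∈ Icc (0 : ℝ) 1, ‖Y (n + 1) (c + (t : ℂ) * (w - c)) - Y n (c + (t : ℂ) * (w - c))‖ ≤
          (M * K ^ n * s ^ n / n !) * t ^ n := by
        intro t ht
        have h := ih _ (ray_mem_ball hR hw ht)
        rw [norm_ray_sub_center c w ht.1] at h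
        calc ‖Y (n + 1) (c + (t : ℂ) * (w - c)) - Y n (c + (t : ℂ) * (w - c))‖ ≤ M * (K * (t * s)) ^ n / n ! := h
          _ = (M * K ^ n * s ^ n / n !) * t ^ n := by ring
      have h := norm_picardMap_sub_picardMap_le_pow hBV hFc hK hLip hR y₀ (hYc (n + 1)) (hYc n) (hYB (n + 1)) (hYB n)
        hw key
      have e : Y (n + 1 + 1) w - Y (n + 1) w = T (Y (n + 1)) w - T (Y n) w := by
        have e2 : Y (n + 1) w = T (Y n) w := by rw [hYsucc n]
        rw [e2, hYsucc (n + 1)]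
      rw [e]
      calc ‖T (Y (n + 1)) w - T (Y n) w‖ ≤ s * (K * (M * K ^ n * s ^ n / n !) / (n + 1)) := h
        _ = M * (K * s) ^ (n + 1) / (n + 1)! := by
          rw [Nat.factorial_succ]
          push_cast
          have h1 : ((n ! : ℕ) : ℝ) ≠ 0 := by positivity
          field_simp
          ring
  -- the summable majorant
  set u : ℕ → ℝ := fun n => M * ((K * R) ^ n / n !) with hu
  have hus : Summable u := (Real.summable_pow_div_factorial (K * R)).mul_left M
  have hbound : ∀ n, ∀ w ∈ ball c R, ‖Y (n + 1) w - Y n w‖ ≤ u n := fun n w hw => by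
    have h1 : (K * ‖w - c‖) ^ n ≤ (K * R) ^ n :=
      pow_le_pow_left₀ (by positivity) (mul_le_mul_of_nonneg_left (hsR w hw) hK) n
    calc ‖Y (n + 1) w - Y n w‖ ≤ M * (K * ‖w - c‖) ^ n / n ! := hest n w hw
      _ ≤ M * (K * R) ^ n / n ! := by gcongr
      _ = u n := by rw [hu]; ring
  -- the limit
  set y : ℂ → E := fun w => ŷ w + ∑' n, (Y (n + 1) w - Y n w) with hy
  have hdiff : DifferentiableOn ℂ (fun w => ∑' n, (Y (n + 1) w - Y n w)) (ball c R) :=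
    Complex.differentiableOn_tsum_of_summable_norm hus (fun n => (hYd (n + 1)).sub (hYd n)) isOpen_ball hbound
  have hyd : DifferentiableOn ℂ y (ball c R) := hŷ.add hdiff
  -- pointwise convergence `Y N w → y w`
  have htel : ∀ w, ∀ N, ŷ w + ∑ i ∈ Finset.range N, (Y (i + 1) w - Y i w) = Y N w := fun w N => by
    rw [Finset.sum_range_sub (fun i => Y i w) N, hY0]; abel
  have hlim : ∀ w ∈ ball c R, Tendsto (fun N => Y N w) atTop (𝓝 (y w)) := fun w hw => by
    have hs : HasSum (fun n => Y (n + 1) w - Y n w) (∑' n, (Y (n + 1) w - Y n w)) :=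
      (Summable.of_norm_bounded hus fun n => hbound n w hw).hasSum
    have h := (hs.tendsto_sum_nat).const_add (ŷ w)
    refine h.congr fun N => htel w N
  -- uniform convergence
  have hunif : ∀ ε : ℝ, 0 < ε → ∃ N₀ : ℕ, ∀ N, N₀ ≤ N → ∀ w ∈ ball c R, ‖y w - Y N w‖ < ε := by
    intro ε hε
    have h := tendstoUniformlyOn_tsum_nat hus (f := fun n w => Y (n + 1) w - Y n w) hbound
    rw [Metric.tendstoUniformlyOn_iff] at h
    obtain ⟨N₀, hN₀⟩ := eventually_atTop.1 (h ε hε)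
    refine ⟨N₀, fun N hN w hw => ?_⟩
    have h1 := hN₀ N hN w hw
    rw [dist_eq_norm] at h1
    have e : y w - Y N w = (∑' n, (Y (n + 1) w - Y n w)) - ∑ n ∈ Finset.range N, (Y (n + 1) w - Y n w) := by
      rw [← htel w N]
      exact add_sub_add_left_eq_sub _ _ _
    rw [e]; exact h1
  -- `y` stays in the tube
  have hyt : ∀ w ∈ ball c R, ‖y w - ŷ w‖ ≤ γ ‖w - c‖ := fun w hw =>
    le_of_tendsto' (((hlim w hw).sub_const (ŷ w)).norm) fun N => hYt N w hw
  have hyB : MapsTo y (ball c R) B := fun u hu =>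
    htube u hu (mem_closedBall.2 (by rw [dist_eq_norm]; exact hyt u hu))
  have hyc : ContinuousOn y (ball c R) := hyd.continuousOn
  -- `y` is a fixed point of the Picard map
  have hfix : ∀ w ∈ ball c R, T y w = y w := by
    intro w hw
    refine eq_of_norm_sub_le_zero (le_of_forall_pos_le_add fun ε hε => ?_)
    rw [zero_add]
    -- choose `N` with `‖y − Y N‖, ‖y − Y (N+1)‖ < ε' := ε / (R K + 2)` uniformly
    set ε' : ℝ := ε / (R * K + 2) with hε'
    have hRK : 0 < R * K + 2 := by positivity
    have hε'0 : 0 < ε' := div_pos hε hRK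
    obtain ⟨N₀, hN₀⟩ := hunif ε' hε'0
    have h1 : ‖T y w - T (Y N₀) w‖ ≤ ‖w - c‖ * ∫ t in (0 : ℝ)..1, K * ε' := by
      refine norm_picardMap_sub_picardMap_le hBV hFc hK hLip hR y₀ hyc (hYc N₀) hyB (hYB N₀) hw continuous_const
        fun t ht => (hN₀ N₀ le_rfl _ (ray_mem_ball hR hw ht)).le
    have h2 : ‖T (Y N₀) w - y w‖ < ε' := by
      rw [← hYsucc, norm_sub_rev]; exact hN₀ (N₀ + 1) (Nat.le_succ _) w hw
    have h3 : ‖w - c‖ * ∫ t in (0 : ℝ)..1, K * ε' ≤ R * K * ε' := by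
      rw [intervalIntegral.integral_const, sub_zero, one_smul]
      calc ‖w - c‖ * (K * ε') ≤ R * (K * ε') := mul_le_mul_of_nonneg_right (hsR w hw) (by positivity)
        _ = R * K * ε' := by ring
    calc ‖T y w - y w‖ = ‖(T y w - T (Y N₀) w) + (T (Y N₀) w - y w)‖ := by congr 1; abel
      _ ≤ ‖T y w - T (Y N₀) w‖ + ‖T (Y N₀) w - y w‖ := norm_add_le _ _
      _ ≤ R * K * ε' + ε' := add_le_add (h1.trans h3) h2.le
      _ = (R * K + 1) * ε / (R * K + 2) := by rw [hε']; ring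
      _ ≤ ε := by
        rw [div_le_iff₀ hRK]
        nlinarith [hε.le]
  refine ⟨y, hyd, ?_, fun w hw => ?_, hyt⟩
  · -- `y c = y₀`: the iterates are `y₀` at the centre from `n = 1` on
    have h1 : Tendsto (fun N => Y N c) atTop (𝓝 y₀) := by
      refine tendsto_atTop_of_eventually_const (i₀ := 1) fun N hN => ?_
      obtain ⟨n, rfl⟩ := Nat.exists_eq_add_of_le' hN
      rw [hYsucc]; exact picardMap_center F c y₀ (Y n)
    exact tendsto_nhds_unique (hlim c (mem_ball_self hR)) h1
  · -- the equation: `y = T y` near `w`, and `(T y)′ = F ∘ y`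
    have hTy : HasDerivAt (T y) (F (y w)) w := hasDerivAt_picardMap hF hR y₀ hyd (fun u hu => hBV (hyB hu)) hw
    refine hTy.congr_of_eventuallyEq ?_
    filter_upwards [isOpen_ball.mem_nhds hw] with u hu
    exact (hfix u hu).symm

/-! ## Uniqueness -/

omit [CompleteSpace E] in
/-- **Uniqueness in the tube.** Two functions satisfying `y′ = F(y)` on the disc, with values in a set `B` on which `F` is
`K`-Lipschitz, and with the same value at the centre, agree on the disc (Grönwall along the rays
`[c, w]`; no holomorphy needed). [cite: CoddingtonLevinson1955, Ch. 1 §8] -/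
theorem solution_unique_of_ball {F : E → E} {B : Set E} {K : ℝ} (hK : 0 ≤ K)
    (hLip : ∀ u ∈ B, ∀ v ∈ B, ‖F u - F v‖ ≤ K * ‖u - v‖) {c : ℂ} {R : ℝ} (hR : 0 < R) {y₁ y₂ : ℂ → E}
    (h₁ : ∀ w ∈ ball c R, HasDerivAt y₁ (F (y₁ w)) w) (h₂ : ∀ w ∈ ball c R, HasDerivAt y₂ (F (y₂ w)) w)
    (hB₁ : MapsTo y₁ (ball c R) B) (hB₂ : MapsTo y₂ (ball c R) B) (h0 : y₁ c = y₂ c) : EqOn y₁ y₂ (ball c R) := by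
  intro z hz
  set f : ℝ → E := fun t => y₁ (c + (t : ℂ) * (z - c)) with hf
  set g : ℝ → E := fun t => y₂ (c + (t : ℂ) * (z - c)) with hg
  set v : ℝ → E → E := fun _ x => (z - c) • F x with hv
  have hf' : ∀ t ∈ Icc (0 : ℝ) 1, HasDerivAt f (v t (f t)) t := fun t ht =>
    ((h₁ _ (ray_mem_ball hR hz ht)).scomp t (hasDerivAt_complexRay c z t))
  have hg' : ∀ t ∈ Icc (0 : ℝ) 1, HasDerivAt g (v t (g t)) t := fun t ht =>
    ((h₂ _ (ray_mem_ball hR hz ht)).scomp t (hasDerivAt_complexRay c z t))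
  set Kl : ℝ≥0 := Real.toNNReal (‖z - c‖ * K) with hKl
  have hlip : ∀ t ∈ Ico (0 : ℝ) 1, LipschitzOnWith Kl (v t) B := by
    intro t _
    refine LipschitzOnWith.of_dist_le_mul fun u hu w hw => ?_
    rw [dist_eq_norm, dist_eq_norm, hv]
    simp only
    rw [← smul_sub, norm_smul]
    have h := hLip u hu w hw
    calc ‖z - c‖ * ‖F u - F w‖ ≤ ‖z - c‖ * (K * ‖u - w‖) := mul_le_mul_of_nonneg_left h (norm_nonneg _)
      _ = ↑Kl * ‖u - w‖ := by rw [hKl, Real.coe_toNNReal _ (by positivity)]; ring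
  have hfc : ContinuousOn f (Icc 0 1) := fun t ht => (hf' t ht).continuousAt.continuousWithinAt
  have hgc : ContinuousOn g (Icc 0 1) := fun t ht => (hg' t ht).continuousAt.continuousWithinAt
  have huniq := ODE_solution_unique_of_mem_Icc_right (v := v) (s := fun _ => B) (K := Kl) (f := f) (g := g)
    (a := 0) (b := 1) hlip hfc (fun t ht => (hf' t ⟨ht.1, ht.2.le⟩).hasDerivWithinAt)
    (fun t ht => hB₁ (ray_mem_ball hR hz ⟨ht.1, ht.2.le⟩)) hgc
    (fun t ht => (hg' t ⟨ht.1, ht.2.le⟩).hasDerivWithinAt) (fun t ht => hB₂ (ray_mem_ball hR hz ⟨ht.1, ht.2.le⟩))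
    (by simp [hf, hg, h0])
  simpa [hf, hg] using huniq ⟨zero_le_one, le_rfl⟩

end Literature.Analysis.ODE

end
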